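import Mathlib
import Literature.Computability.AlgebraicComplexity.Hyperdeterminant
import Literature.Computability.AlgebraicComplexity.OrbitClosureProofs
import Summits.ValiantsHypothesis.ValiantsHypothesis.Theorems.DetQPDetqpThesisStubIsVNPFamilyHyperdet
import Summits.ValiantsHypothesis.ValiantsHypothesis.Theorems.DetQPDetqpThesisStubIsPProjectionHyperdetPerPoly
import Summits.ValiantsHypothesis.ValiantsHypothesis.Theorems.DetQPDetqpThesisHyperdetCalibrationHomogenize
import Summits.ValiantsHypothesis.ValiantsHypothesis.Theorems.DetQPDetqpThesisHyperdetWitnessCalibration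

/-!
# Crux `DetQP.DetqpThesis` (stmt-ValiantsHypothesis-0315), line `four-dimensional-determinant` —
# calibration of stub C, part 2b: the padded permanent and the padded four-dimensional
# determinant inside `Δ(det_m)`

* `hdc2_exists_blockEmb`, `hdc2_paddedPerPoly_eq` — the bottom-right block embedding
  `i ↦ m - n + i` and `paddedPerPoly ℂ n m = X₀₀^{m-n} · per_n(X_block)`;
* `hdc2_exists_perPoly_proj` — the explicit projection `per_{n+d} → per_n` (unit corner entries,
  `x₀₀ ↦ 1` as soon as `d ≥ 1`; iterating `isProjection_perPoly_succ`);
* `hdc2_paddedPer_mem_orbitClosure_of_le` — **membership is downward monotone in `n`**: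
  `X₀₀^{m-N} per_N ∈ Δ(det_m)`, `n ≤ N ≤ m` ⇒ `X₀₀^{m-n} per_n ∈ Δ(det_m)`;
* `hdc2_paddedHyperdet_mem_orbitClosure_of_per` — **`VNP`-completeness in padded form**: with the
  p-bounded `t` of `H ≤_p per` (`stub_isPProjection_hyperdet_perPoly`, LANDED),
  `X₀₀^{m-t'} per_{t'} ∈ Δ(det_m)`, `t' = max (t n) n < m` ⇒ `X₀₀^{m-n} H_n(X_ι) ∈ Δ(det_m)`.

Both are instances of `hdc2_padded_mem_endOrbit` (part 2a) plus `End · f ⊆ Δ(f)` and the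
transitivity of orbit closures.  Part 2c assembles the equivalence of the line's bet C with
`GCTMult.GctThesis`.  Folklore (Mulmuley–Sohoni 2001 §4; Bürgisser 2000 §2.1; Valiant 1979).
-/

open MvPolynomial
open scoped BigOperators

namespace Summit.ValiantsHypothesis.ValiantsHypothesis.Theorems.DetQPDetqpThesis.HdCalibration

set_option linter.dupNamespace false

open Literature.Computability.AlgebraicComplexity

/-! ## The block embedding and the padded permanent -/

/-- The bottom-right block embedding `Fin n → Fin m`, `i ↦ m - n + i` (`n ≤ m`). -/
theorem hdc2_exists_blockEmb {n m : ℕ} (hnm : n ≤ m) :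
    ∃ e : Fin n → Fin m, ∀ i, ((e i : Fin m) : ℕ) = m - n + i :=
  ⟨fun i => ⟨m - n + i, by omega⟩, fun _ => rfl⟩

/-- A block embedding is injective. -/
theorem hdc2_blockEmb_injective {n m : ℕ} (e : Fin n → Fin m) (he : ∀ i, ((e i : Fin m) : ℕ) = m - n + i) :
    Function.Injective e := by
  intro i j h
  have h1 := congrArg (fun x : Fin m => (x : ℕ)) h
  simp only [he] at h1
  exact Fin.ext (by omega)

/-- **The padded permanent through the block embedding**:
`paddedPerPoly ℂ n m = X₀₀^{m-n} · rename (e × e) per_n`. -/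
theorem hdc2_paddedPerPoly_eq {n m : ℕ} [NeZero m] (hnm : n ≤ m) (e : Fin n → Fin m)
    (he : ∀ i, ((e i : Fin m) : ℕ) = m - n + i) :
    paddedPerPoly ℂ n m = X ((0 : Fin m), (0 : Fin m)) ^ (m - n) *
      rename (Prod.map e e) (perPoly (Fin n) ℂ) := by
  -- the explicit equivalence `Fin n ≃ BlockIdx n m`
  set ε : Fin n ≃ BlockIdx n m :=
    { toFun := fun i => ⟨e i, by rw [he]; omega⟩
      invFun := fun j => ⟨(j : Fin m) - (m - n), by have := j.2; have := (j : Fin m).isLt; omega⟩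
      left_inv := fun i => by
        apply Fin.ext
        simp only [he]
        omega
      right_inv := fun j => by
        apply Subtype.ext
        apply Fin.ext
        simp only [he]
        have := j.2
        omega } with hε
  unfold paddedPerPoly
  congr 1
  rw [← rename_perPoly_equiv (k := ℂ) ε, rename_rename]
  rfl

/-! ## The explicit projection `per_{n+d} → per_n` -/

/-- **`per_n` is a projection of `per_{n+d}` with unit corner entries**: there is `a` (variables
or constants) with `per_{n+d}(a) = per_n` and `a(i,i) = 1` on the first `d` diagonal positions —
in particular `a(0,0) = 1` when `d ≥ 1`. -/
theorem hdc2_exists_perPoly_proj (n d : ℕ) :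
    ∃ a : Fin (n + d) × Fin (n + d) → MvPolynomial (Fin n × Fin n) ℂ,
      (∀ p, (∃ j, a p = X j) ∨ ∃ c, a p = C c) ∧
      aeval a (perPoly (Fin (n + d)) ℂ) = perPoly (Fin n) ℂ ∧
      (∀ p : Fin (n + d) × Fin (n + d), (p.1 : ℕ) = 0 → (p.2 : ℕ) = 0 → 0 < d → a p = C 1) := by
  classical
  induction d with
  | zero =>
    refine ⟨fun p => X p, fun p => Or.inl ⟨p, rfl⟩, ?_, fun p _ _ hd => absurd hd (lt_irrefl 0)⟩
    exact aeval_X_left_apply _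
  | succ d ih =>
    obtain ⟨a, ha, haev, hdiag⟩ := ih
    let a' : Fin (n + d + 1) × Fin (n + d + 1) → MvPolynomial (Fin n × Fin n) ℂ := fun p =>
      Fin.cases (Fin.cases (C 1) (fun _ => C 0) p.2)
        (fun i => Fin.cases (C 0) (fun j => a (i, j)) p.2) p.1
    have ha00 : a' (0, 0) = C 1 := by simp [a']
    have ha0s : ∀ j : Fin (n + d), a' (0, j.succ) = C 0 := fun j => by simp [a']
    have has0 : ∀ i : Fin (n + d), a' (i.succ, 0) = C 0 := fun i => by simp [a']
    have hass : ∀ i j : Fin (n + d), a' (i.succ, j.succ) = a (i, j) := fun i j => by simp [a']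
    refine ⟨a', fun p => ?_, ?_, fun p hp1 hp2 _ => ?_⟩
    · obtain ⟨i, j⟩ := p
      refine Fin.cases ?_ (fun i' => ?_) i <;> refine Fin.cases ?_ (fun j' => ?_) j
      · exact Or.inr ⟨1, ha00⟩
      · exact Or.inr ⟨0, ha0s j'⟩
      · exact Or.inr ⟨0, has0 i'⟩
      · rw [hass]; exact ha (i', j')
    · have h : aeval a' (perPoly (Fin (n + d + 1)) ℂ) = (Matrix.of fun i j => a' (i, j)).permanent := by
        simp [perPoly, Matrix.permanent, map_sum, map_prod]
      have h' : aeval a (perPoly (Fin (n + d)) ℂ) = (Matrix.of fun i j => a (i, j)).permanent := by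
        simp [perPoly, Matrix.permanent, map_sum, map_prod]
      show aeval a' (perPoly (Fin (n + d + 1)) ℂ) = perPoly (Fin n) ℂ
      rw [h, Matrix.permanent_eq_sum_row_zero, Fin.sum_univ_succ]
      have hsub : (Matrix.of fun i j => a' (i, j)).submatrix Fin.succ (Fin.succAbove 0) =
          Matrix.of fun i j => a (i, j) := by
        ext i j
        simp [Fin.succAbove_zero, hass]
      simp only [Matrix.of_apply, ha00, ha0s, C_0, zero_mul, Finset.sum_const_zero, add_zero, C_1,
        one_mul, hsub]
      rw [← h', haev]
    · obtain ⟨i, j⟩ := p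
      have hi : i = 0 := Fin.ext hp1
      have hj : j = 0 := Fin.ext hp2
      subst hi hj
      exact ha00

/-! ## Membership is downward monotone in `n` -/

/-- **Downward monotonicity**: if `X₀₀^{m-N} per_N ∈ Δ(det_m)` and `n ≤ N ≤ m` then
`X₀₀^{m-n} per_n ∈ Δ(det_m)` (the padded `per_n` is a linear-substitution instance of the padded
`per_N`: block variables stay, the `N - n` extra diagonal entries become `X₀₀`, the rest `0`). -/
theorem hdc2_paddedPer_mem_orbitClosure_of_le {n N m : ℕ} [NeZero m] (hnN : n ≤ N) (hNm : N ≤ m)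
    (hmem : paddedPerPoly ℂ N m ∈ orbitClosure (detPoly (Fin m) ℂ)) :
    paddedPerPoly ℂ n m ∈ orbitClosure (detPoly (Fin m) ℂ) := by
  classical
  obtain ⟨d, rfl⟩ := Nat.exists_eq_add_of_le hnN
  rcases Nat.eq_zero_or_pos d with hd | hd
  · subst hd; simpa using hmem
  refine orbitClosure_subset_of_mem_holds hmem (endOrbit_subset_orbitClosure_holds _ ?_)
  obtain ⟨eN, heN⟩ := hdc2_exists_blockEmb hNm
  obtain ⟨en, hen⟩ := hdc2_exists_blockEmb (le_trans hnN hNm)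
  obtain ⟨a, ha, haev, hdiag⟩ := hdc2_exists_perPoly_proj n d
  have hfN : (perPoly (Fin (n + d)) ℂ).IsHomogeneous (n + d) := by
    simpa [Fintype.card_fin] using perPoly_isHomogeneous (n := Fin (n + d)) (k := ℂ)
  have hfn : (perPoly (Fin n) ℂ).IsHomogeneous n := by
    simpa [Fintype.card_fin] using perPoly_isHomogeneous (n := Fin n) (k := ℂ)
  rw [hdc2_paddedPerPoly_eq hNm eN heN, hdc2_paddedPerPoly_eq (le_trans hnN hNm) en hen]
  refine hdc2_padded_mem_endOrbit hfN hfn hnN hNm a ha haev.symm (Prod.map eN eN)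
    ((hdc2_blockEmb_injective eN heN).prodMap (hdc2_blockEmb_injective eN heN)) (fun p hp => ?_)
    (Prod.map en en)
  -- the padding position is hit only when `N = m`, and then it is the corner `(0,0)` of `per_N`
  simp only [Prod.map, Prod.mk.injEq] at hp
  have h1 := congrArg (fun x : Fin m => (x : ℕ)) hp.1
  have h2 := congrArg (fun x : Fin m => (x : ℕ)) hp.2
  simp only [heN, Fin.val_zero] at h1 h2
  exact hdiag p (by omega) (by omega) hd

/-! ## `VNP`-completeness in padded form -/

/-- There is a p-bounded `t` with `n ≤ t n` and `H_n` a projection of `per_{t n}` for all `n`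
(`stub_isPProjection_hyperdet_perPoly` + `stub_isVNPFamily_hyperdet`, both LANDED, composed with
the projection `per_{t n} → per_{max (t n) n}` of `hdc2_exists_perPoly_proj`). -/
theorem hdc2_exists_proj_bound :
    ∃ t : ℕ → ℕ, IsPBounded t ∧ (∀ n, n ≤ t n) ∧
      ∀ n, IsProjection (hyperdet fun I : Fin 4 → Fin n => (X I : MvPolynomial (Fin 4 → Fin n) ℂ))
        (perPoly (Fin (t n)) ℂ) := by
  obtain ⟨t, ht, hproj⟩ :=
    Summit.ValiantsHypothesis.ValiantsHypothesis.Theorems.DetQPDetqpThesis.stub_isPProjection_hyperdet_perPoly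
      Summit.ValiantsHypothesis.ValiantsHypothesis.Theorems.DetQPDetqpThesis.stub_isVNPFamily_hyperdet
  refine ⟨fun n => t n + (n - t n), ?_, fun n => by show n ≤ t n + (n - t n); omega, fun n => ?_⟩
  · obtain ⟨c, hc⟩ := ht
    refine ⟨c + 1, fun n => ?_⟩
    show t n + (n - t n) ≤ n ^ (c + 1) + (c + 1)
    have h1 := hc n
    have key : n ^ c + n ≤ n ^ (c + 1) + 1 := by
      rcases Nat.eq_zero_or_pos n with h | h
      · subst h
        rcases Nat.eq_zero_or_pos c with hc0 | hc0
        · subst hc0; simp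
        · simp [Nat.zero_pow hc0]
      · have hp : 1 ≤ n ^ c := Nat.one_le_pow _ _ h
        rw [pow_succ]
        nlinarith
    omega
  · obtain ⟨a, ha, haev, -⟩ := hdc2_exists_perPoly_proj (t n) (n - t n)
    exact IsProjection.trans_holds (hproj n) ⟨a, ha, haev.symm⟩

/-- **Padded completeness**: with `t` as in `hdc2_exists_proj_bound`, if `X₀₀^{m - t n} per_{t n}`
lies in `Δ(det_m)` and `t n < m`, then so does `X₀₀^{m-n} H_n(X_ι)`, for every placement `ι`. -/
theorem hdc2_paddedHyperdet_mem_orbitClosure_of_per {n m : ℕ} [NeZero m] {t : ℕ → ℕ}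
    (hnt : n ≤ t n)
    (hproj : IsProjection (hyperdet fun I : Fin 4 → Fin n => (X I : MvPolynomial (Fin 4 → Fin n) ℂ))
      (perPoly (Fin (t n)) ℂ))
    (htm : t n < m) (hmem : paddedPerPoly ℂ (t n) m ∈ orbitClosure (detPoly (Fin m) ℂ))
    (ι : (Fin 4 → Fin n) → Fin m × Fin m) :
    X ((0 : Fin m), (0 : Fin m)) ^ (m - n) *
        rename ι (hyperdet fun I : Fin 4 → Fin n => (X I : MvPolynomial (Fin 4 → Fin n) ℂ)) ∈
      orbitClosure (detPoly (Fin m) ℂ) := by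
  classical
  refine orbitClosure_subset_of_mem_holds hmem (endOrbit_subset_orbitClosure_holds _ ?_)
  obtain ⟨e, he⟩ := hdc2_exists_blockEmb htm.le
  obtain ⟨a, ha, haev⟩ := hproj
  have hf : (perPoly (Fin (t n)) ℂ).IsHomogeneous (t n) := by
    simpa [Fintype.card_fin] using perPoly_isHomogeneous (n := Fin (t n)) (k := ℂ)
  have hg : (hyperdet fun I : Fin 4 → Fin n => (X I : MvPolynomial (Fin 4 → Fin n) ℂ)).IsHomogeneous n :=
    hdc_hyperdet_X_isHomogeneous n
  rw [hdc2_paddedPerPoly_eq htm.le e he]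
  refine hdc2_padded_mem_endOrbit hf hg hnt htm.le a ha haev (Prod.map e e)
    ((hdc2_blockEmb_injective e he).prodMap (hdc2_blockEmb_injective e he)) (fun p hp => ?_) ι
  -- `t n < m`: the block misses the padding position
  exfalso
  simp only [Prod.map, Prod.mk.injEq] at hp
  have h1 := congrArg (fun x : Fin m => (x : ℕ)) hp.1
  simp only [he, Fin.val_zero] at h1
  omega

end Summit.ValiantsHypothesis.ValiantsHypothesis.Theorems.DetQPDetqpThesis.HdCalibration
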